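import Summits.QuantumFields.YangMills.Theorems.FluctuationComparisonRegPrIntLS2BetaCurlBudgetOfChartTower
import Summits.QuantumFields.YangMills.Theorems.FluctuationComparisonRegPrIntLS2BetaCoarseCurlRowsRem
import Summits.QuantumFields.YangMills.Theorems.FluctuationComparisonRegPrIntLS2BetaChartReadDescentOntoExpPoint
import Literature.MathematicalPhysics.QuantumFieldTheory.Balaban1983to89.T4ExpWindowSmallField
import Literature.MathematicalPhysics.QuantumFieldTheory.Balaban1983to89.B10Eq18SigmaSU2Window
import HarnessLib

/-!
# S2β · (SCT″-c)₁ G4-ii — «THE LINEARISED LADDER AND THE JUNCTION OUTSIDE IT» (ARCHITECT RULING «SRC-VOL» 2026-08-31T23:30:47Z: quadratic remainders may NOT ride as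
# fine-site sources of the curl ladder — they are priced in READ-SUP currency as window-small `S′`-shares).  Successor edition of ✓p836340 G4-i: the ladder family is
# `ρ :=` the GROUP size at level `0` (JNC-0) and the LINEARISED curl `‖Y_{Ū^nU₀}(∂q)[X̂_n]‖` at every level `n ≥ 1` — NO BCH remainder inside; the sources are M-1‴'s `src`
# (plaquette-class × chord, class (a) of «SRC-VOL») + `4R` + the ONE `0 → 1` junction term; the c₁ TEXT is then bounded by TWICE the ladder's read energies plus TWICE the
# READ-SUP of the BCH remainder `e^S − 1 − S` (file `…CurlBudgetJunctionSplit`), which the assembler prices as `β_junc·S′` with `β_junc ∝ M̄²` (window constants, «FB-σ»)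

Cell `ym3-torus` (YM ladder rung R3 = continuum `SU(2)` Yang–Mills on the three-torus at fixed lattice data — a RUNG: NOT d = 4, NOT infinite volume, NOT a mass gap,
NOT Clay).  Width seat «width 10» `ym3-torus-px10` (gen 26); crux `stmt-QuantumFields-20520`, LINE g18-1 S2β; G4-ii (px17 g23 «GO NOW»).
`--kind proof --supports stmt-QuantumFields-20520 --as helper`, count-neutral, DEFINITION-FREE (0 `def`, 0 `instance`, 0 `notation`, 0 `sorry`, default heartbeats).

WHAT IS PROVED (sorry-free).  In `…CurlBudgetOfChartTowerSup`: ★★★`linBudget_of_chartTower` — at FIXED data, with the quaternionic chart tower `X` (`hXdef`, consumer passes `rfl`):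
from (T) (window `1∕4`), M-1‴'s classes `α δ αp` (+ signs), corner sizes `M`, free remainder `R`, and the source ENERGY in ROW form
`Σ_{i<K−J} w(i+1)·L^{K−J−1−(i+1)}·Σ_μΣ_νΣ_{y′}(𝟙[μ<ν]·(src_{M-1‴}(i+1,y′) + 𝟙[i=0]·|Idx|⁻¹Σ_a rem(0,pos_a y′)))² ≤ Bsrc` (NO `rem(i+1)` term any more):
**`Σ_{t<K−J} L^t·(Cst·Σ_B ‖𝟙_read·ρ_{K−J−1−t}‖²) ≤ (2·Cst·κ²νC_b)·(4·L⁻¹·(L^{K−J}·REL) + W·Bsrc)`** (✓`curlBudget_core_abs` at `g := ρ`; rows = M-1‴ for `i ≥ 1`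
verbatim, the `0 → 1` step through the mirror junction).  In `…CurlBudgetJunctionSplit`: ★`sq_le_two_sq_add_two_sq_of_le_add`; ★★`dist_le_rho_add_rem` (group size ≤ `ρ` + `rem`, all levels);
★★★`c1_le_two_lin_add_two_rem`: **`Σ_t L^t·c₁(t) ≤ 2·Σ_t L^t·(Cst·Σ_B ‖𝟙_read·ρ‖²) + 2·Σ_t L^t·(Cst·Σ_B ‖𝟙_read·rem‖²)`** — the second summand is the junction in READ-SUP
currency (`rem_n(x) ≤ 16·Mg n·(Σ of the four chart norms)` under (T), so it is `≤ 512·Cst·M̄²·Σ_t L^t Σ_B ‖𝟙_read·‖X‖‖²`: a cover of `E′` and a window-small `β`).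
SOURCE CLASSES («SRC-VOL», architect px17 g23 2026-08-31T23:42:13Z).  `hBsrc` is a FINE-SITE ℓ² energy — forced by the only engine on the tree (✓`weighted_readMax_sq_le_sources`:
read-max output, fine-site data and sources, Schur dilution per level).  It is K-uniformly inhabitable EXACTLY for sources whose coefficients DECAY like plaquette classes:
the binders `hα` (loops of the BACKGROUND tower `Ū^iU₀`), `hUs` (`PlaqSmall (δ(i+1)) (Ū^iU₀)`), `hαp` (coarse plaquettes of `avgFun … (Ū^iU₀)`) are BACKGROUND-tower classes —
BKG-class (`∝ C_B·α·L^{2i−2(K−J)}`) under the station's (BKG) binder ⇒ the `δ·M`, `α·M`, `αp·M` terms of `src` and `R`'s `δM²` piece are affordable (pure purse); `R`'s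
CHORD-class pieces (`κM²`, `Ō·M`, `Ō²` of (β-3)′) are NOT affordable as fine-site sources unless re-read as plaquette-class × chord (HAZARD-candidate «SRC-VOL-R»); the `0 → 1`
junction term is affordable iff the finest relative chord is lattice-spacing small ((SUP-DECAY)₀).
WHAT IS LEFT by name: (T) (w4's (b)); (SRC-LIN) = the energy of M-1‴'s LINEAR sources from (BKG) + ONE (L2-TOWER) letter (px12 first refusal); `R`'s class ((β-3)′ must be
re-read as plaquette-class × chord — px13); the `0 → 1` junction's energy carries `Mg 0²·L^{2(K−J)+2}` (pure purse iff the finest relative chord is lattice-spacing small —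
(SUP-DECAY)₀, px12∕px21); the junction share's cover constant `C_cov` (px21).

HONEST SCOPE.  Identification + re-plumbing over LANDED letters (M-1‴ ✓p835604, junctions ✓p832898∕✓p833305, core ✓p835744, O's shape ✓p835698, lit chart lemmas); nothing of
Bałaban's renormalisation-group analysis is asserted or proved ([Balaban1985Averaging] (19)–(20) p.21, (56)–(58) p.27, Prop. 4 (128)–(135) pp.37–38; [Balaban1987RG1] (0.1)–(0.4),
(0.8), (0.11) pp.251–253 are the printed rows these letters transcribe); (T), the classes, the sizes `M`, the letter `R`, the source ENERGY (SRC), the doors (α)(β)(γ), (iii),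
the SUPPLIER KNIT, (ST⁗)∕LOC⁗, h3 are HYPOTHESES or others'; GAP♯∘ (`stub_uniformFibreGapOrbit`, registry `Lines/semiclassical_s2beta.lean` 3732b7df UNTOUCHED, 0∕5), S2β, the
five registered stubs, crux 20520, 19936, 19200 and `YM3TorusSU2` are NOT proved; no registered stub is closed; rung R3 = SU(2) YM₃ on T³ at fixed lattice data — NOT d = 4, NOT
infinite volume, NOT a mass gap, NOT Clay; the Yang–Mills mass gap is NOT proved.
-/

set_option autoImplicit false

noncomputable section

open scoped Matrix.Norms.L2Operator
open Finset

namespace Summit.QuantumFields.YangMills.Theorems.FluctuationComparisonRegPrIntLS2BetaCurlBudgetJunctionSplit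

open Literature.MathematicalPhysics.QuantumFieldTheory.Balaban1983to89
open Literature.MathematicalPhysics.QuantumFieldTheory.Balaban1983to89.T4Continuum
open Literature.MathematicalPhysics.QuantumFieldTheory.Balaban1983to89.T3ContinuumYM3Torus
open Literature.MathematicalPhysics.QuantumFieldTheory.Balaban1983to89.T3LevelShift
open Literature.MathematicalPhysics.QuantumFieldTheory.Balaban1983to89.T3UnitLawDensityEML (ℰp)
open Literature.MathematicalPhysics.QuantumFieldTheory.Balaban1983to89.T4HaarSU2ExpChart (expPoint)
open Literature.MathematicalPhysics.QuantumFieldTheory.Balaban1983to89.T4ExpWindowSmallField (logVec expPoint_logVec)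
open Literature.MathematicalPhysics.QuantumFieldTheory.Balaban1983to89.HaarExponentialChart
open Literature.MathematicalPhysics.QuantumFieldTheory.Balaban1983to89.HaarExponentialChart.IsChartRep
open Literature.MathematicalPhysics.QuantumFieldTheory.Balaban1983to89.BlockAveraging (Idx blockAvg avgFun loopHol blockAvg_avg)
open Literature.MathematicalPhysics.QuantumFieldTheory.Balaban1983to89.ExpMeanLog (expMeanLogSU deltaSU)
open Literature.MathematicalPhysics.QuantumFieldTheory.Balaban1983to89.BlockAveragingEMLLinearisedBackground (covWalkSum)
open Literature.MathematicalPhysics.QuantumFieldTheory.Balaban1983to89.B10Eq47AxialChi (shiftN)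
open Literature.MathematicalPhysics.QuantumFieldTheory.Balaban1983to89.B14.Eq22Determines (blockIter)
open Literature.MathematicalPhysics.QuantumFieldTheory.Balaban1983to89.B10Eq27TorusAxialLog (rel)
open Literature.MathematicalPhysics.QuantumFieldTheory.Balaban1983to89.B10Eq18SigmaSU2 (su2Coord)
open Literature.MathematicalPhysics.QuantumFieldTheory.Balaban1983to89.B10Eq18SigmaSU2Haar (rev norm_rev)
open Literature.MathematicalPhysics.QuantumFieldTheory.Balaban1983to89.B10Eq18SigmaSU2Window (norm_su2Coord)
open Literature.MathematicalPhysics.QuantumLattice (su2Quat)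
open Summit.QuantumFields.YangMills.Theorems.FluctuationComparisonRegPrIntLS2BetaChartReadDescentOntoExpPoint (su2Coord_rev_mem_lie expPoint_eq_expChart)
open Summit.QuantumFields.YangMills.Theorems.FluctuationComparisonRegPrIntLS2BetaCurlBudgetOfChartTower (eq_expChart_logVecChart_mul logVecChart_eq_logChart srcM_nonneg)
open Summit.QuantumFields.YangMills.Theorems.FluctuationComparisonRegPrIntLS2BetaCurlBudgetEngine (kernelConst_nonneg)
open Summit.QuantumFields.YangMills.Theorems.FluctuationComparisonRegPrIntLS2BetaCoarseCurlRowsRem (rows_LL_tower_of_remainder_K5)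
open Summit.QuantumFields.YangMills.Theorems.FluctuationComparisonRegPrIntLS2BetaRelPlaqCurlJunction (dist1_relPlaq_le_curl_add_rem norm_curl_le_dist1_relPlaq_add_rem)
open Summit.QuantumFields.YangMills.Theorems.FluctuationComparisonRegPrIntLS2BetaSupTowerTerm (pi_norm_le_of_pointwise)

variable (F : T3Family)


/-- ★ `a ≤ b + c`, `0 ≤ a` ⇒ `a² ≤ 2b² + 2c²`. [folklore] -/
theorem sq_le_two_sq_add_two_sq_of_le_add {a b c : ℝ} (ha : 0 ≤ a) (h : a ≤ b + c) : a ^ 2 ≤ 2 * b ^ 2 + 2 * c ^ 2 := by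
  have h2 : a ^ 2 ≤ (b + c) ^ 2 := pow_le_pow_left₀ ha h 2
  nlinarith [sq_nonneg (b - c)]

/-! ## §2 The BCH junction OUTSIDE the ladder: the c₁ TEXT splits into the linearised read energies and a READ-SUP remainder -/

/-- ★★ **POINTWISE**: the group-currency relative plaquette size is at most the ladder family `ρ` (group at level `0`, linearised curl above) plus the BCH remainder
`rem_n = e^S − 1 − S` (✓`dist1_relPlaq_le_curl_add_rem` after the global tower identity; trivial at level `0`). [cite: Balaban1985Averaging, (58) p.27; Balaban1987RG1, (0.8) p.253] -/
theorem dist_le_rho_add_rem {K : ℕ} (U₀ : GaugeField (F.P K) 0 (Matrix.specialUnitaryGroup (Fin 2) ℂ)) (ζ : PBond (F.P K) 0 → EuclideanSpace ℝ (Fin 3))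
    (X : (i : ℕ) → PBond (F.P K) i → (specialUnitaryLogChart (Fin 2)).lie)
    (hXdef : X = fun (i : ℕ) (b : PBond (F.P K) i) =>
      (⟨su2Coord (rev (logVec (su2Quat (Averaging.iter (fun k => BlockAveraging.blockAvg (P := F.P K) (j := k) ℰp) i (fun ℓ => expPoint (ζ ℓ) * U₀ ℓ : GaugeField (F.P K) 0 (Matrix.specialUnitaryGroup (Fin 2) ℂ)) b * (Averaging.iter (fun k => BlockAveraging.blockAvg (P := F.P K) (j := k) ℰp) i U₀ b)⁻¹)))), su2Coord_rev_mem_lie _⟩ : (specialUnitaryLogChart (Fin 2)).lie)) (n : ℕ) (p : Plaq (F.P K) n) :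
    dist1 ((GaugeField.plaqHol (Averaging.iter (fun k => BlockAveraging.blockAvg (P := F.P K) (j := k) ℰp) n U₀) p)⁻¹ *
          GaugeField.plaqHol (Averaging.iter (fun k => BlockAveraging.blockAvg (P := F.P K) (j := k) ℰp) n
            (fun ℓ => expPoint (ζ ℓ) * U₀ ℓ : GaugeField (F.P K) 0 (Matrix.specialUnitaryGroup (Fin 2) ℂ))) p) ≤
      (fun (μ ν : Fin (F.P K).d) (i : ℕ) (x : Site (F.P K) i) =>
      (if h : μ < ν then (if i = 0 then dist1 ((GaugeField.plaqHol (Averaging.iter (fun k => BlockAveraging.blockAvg (P := F.P K) (j := k) ℰp) i U₀) ⟨x, μ, ν, h⟩)⁻¹ *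
          GaugeField.plaqHol (Averaging.iter (fun k => BlockAveraging.blockAvg (P := F.P K) (j := k) ℰp) i (fun ℓ => expPoint (ζ ℓ) * U₀ ℓ : GaugeField (F.P K) 0 (Matrix.specialUnitaryGroup (Fin 2) ℂ))) ⟨x, μ, ν, h⟩) else ‖covWalkSum (Averaging.iter (fun k => BlockAveraging.blockAvg (P := F.P K) (j := k) ℰp) i U₀) (fun b => ((X i b : (specialUnitaryLogChart (Fin 2)).lie) : Matrix (Fin 2) (Fin 2) ℂ))
          (walk x [((μ, true) : Letter (F.P K).d), (ν, true), (μ, false), (ν, false)])‖) else 0)) p.μ p.ν n p.src + (Real.exp (‖X n ⟨p.src, p.μ⟩‖ + ‖X n ⟨(p.src).shift p.μ, p.ν⟩‖ + ‖X n ⟨(p.src).shift p.ν, p.μ⟩‖ + ‖X n ⟨p.src, p.ν⟩‖) - 1 - (‖X n ⟨p.src, p.μ⟩‖ + ‖X n ⟨(p.src).shift p.μ, p.ν⟩‖ + ‖X n ⟨(p.src).shift p.ν, p.μ⟩‖ + ‖X n ⟨p.src, p.ν⟩‖)) := by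
  have hrem : ∀ s : ℝ, 0 ≤ Real.exp s - 1 - s := fun s => by linarith [Real.add_one_le_exp s]
  beta_reduce
  rw [dif_pos p.hμν]
  by_cases h0 : n = 0
  · subst h0
    rw [if_pos rfl]
    exact le_add_of_nonneg_right (hrem _)
  · rw [if_neg h0]
    have hstage : Averaging.iter (fun k => BlockAveraging.blockAvg (P := F.P K) (j := k) ℰp) n (fun ℓ => expPoint (ζ ℓ) * U₀ ℓ : GaugeField (F.P K) 0 (Matrix.specialUnitaryGroup (Fin 2) ℂ)) = fun c => (isChartRep_specialUnitaryGroup (n := Fin 2)).expChart (X n c) * Averaging.iter (fun k => BlockAveraging.blockAvg (P := F.P K) (j := k) ℰp) n U₀ c := by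
      rw [hXdef]; exact eq_expChart_logVecChart_mul (Averaging.iter (fun k => BlockAveraging.blockAvg (P := F.P K) (j := k) ℰp) n (fun ℓ => expPoint (ζ ℓ) * U₀ ℓ : GaugeField (F.P K) 0 (Matrix.specialUnitaryGroup (Fin 2) ℂ))) (Averaging.iter (fun k => BlockAveraging.blockAvg (P := F.P K) (j := k) ℰp) n U₀)
    have hj := dist1_relPlaq_le_curl_add_rem (P := F.P K) (N := 2) (Averaging.iter (fun k => BlockAveraging.blockAvg (P := F.P K) (j := k) ℰp) n U₀) (X n) p.src p.hμν
    rw [← hstage] at hj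
    exact hj

/-- ★★★ **THE c₁ TEXT SPLITS**: `Σ_t L^t·c₁(t) ≤ 2·Σ_t L^t·(Cst·Σ_B ‖𝟙_read·ρ‖²) + 2·Σ_t L^t·(Cst·Σ_B ‖𝟙_read·rem‖²)` — the second summand is the BCH junction in READ-SUP
currency (ONE Pi-sup per coarsest bond, the `S′` currency; ARCHITECT RULING «SRC-VOL»: it is priced there as a window-small `S′`-share, never as a fine-site source).
[cite: Balaban1985Averaging, Prop. 4 (128)-(135) pp.37-38; Balaban1987RG1, (0.11) p.253] -/
theorem c1_le_two_lin_add_two_rem {J K : ℕ} (hJK : J ≤ K) (θr : ℕ) (Cst : ℝ) (hCst : 0 ≤ Cst)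
    (U₀ : GaugeField (F.P K) 0 (Matrix.specialUnitaryGroup (Fin 2) ℂ)) (ζ : PBond (F.P K) 0 → EuclideanSpace ℝ (Fin 3))
    (X : (i : ℕ) → PBond (F.P K) i → (specialUnitaryLogChart (Fin 2)).lie)
    (hXdef : X = fun (i : ℕ) (b : PBond (F.P K) i) =>
      (⟨su2Coord (rev (logVec (su2Quat (Averaging.iter (fun k => BlockAveraging.blockAvg (P := F.P K) (j := k) ℰp) i (fun ℓ => expPoint (ζ ℓ) * U₀ ℓ : GaugeField (F.P K) 0 (Matrix.specialUnitaryGroup (Fin 2) ℂ)) b * (Averaging.iter (fun k => BlockAveraging.blockAvg (P := F.P K) (j := k) ℰp) i U₀ b)⁻¹)))), su2Coord_rev_mem_lie _⟩ : (specialUnitaryLogChart (Fin 2)).lie)) :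
    ∑ t ∈ Finset.range (K - J), (F.L : ℝ) ^ t * (fun t => Cst * ∑ B : PBond (F.P J) 0,
      ‖(fun p : Plaq (F.P K) (K - J - 1 - t) =>
        if ∃ z₀ : Site (F.P K) 0, (blockIter (K - J) z₀ = (bondShift (F.sitesPerDir_eq (m := F.m) (K := J) (j := 0) (m' := F.m) (K' := K) (j' := K - J) (by omega)) B).src ∨
            blockIter (K - J) z₀ = (bondShift (F.sitesPerDir_eq (m := F.m) (K := J) (j := 0) (m' := F.m) (K' := K) (j' := K - J) (by omega)) B).tgt) ∧
            ∀ κ, (rel (blockIter (K - J - 1 - t) z₀) p.src κ).natAbs ≤ θr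
        then dist1 ((GaugeField.plaqHol (Averaging.iter (fun k => BlockAveraging.blockAvg (P := F.P K) (j := k) ℰp) (K - J - 1 - t) U₀) p)⁻¹ *
          GaugeField.plaqHol (Averaging.iter (fun k => BlockAveraging.blockAvg (P := F.P K) (j := k) ℰp) (K - J - 1 - t)
            (fun ℓ => expPoint (ζ ℓ) * U₀ ℓ : GaugeField (F.P K) 0 (Matrix.specialUnitaryGroup (Fin 2) ℂ))) p)
        else 0)‖ ^ 2) t ≤
      2 * ∑ t ∈ Finset.range (K - J), (F.L : ℝ) ^ t * (fun t => Cst * ∑ B : PBond (F.P J) 0,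
      ‖(fun p : Plaq (F.P K) (K - J - 1 - t) =>
        if ∃ z₀ : Site (F.P K) 0, (blockIter (K - J) z₀ = (bondShift (F.sitesPerDir_eq (m := F.m) (K := J) (j := 0) (m' := F.m) (K' := K) (j' := K - J) (by omega)) B).src ∨
            blockIter (K - J) z₀ = (bondShift (F.sitesPerDir_eq (m := F.m) (K := J) (j := 0) (m' := F.m) (K' := K) (j' := K - J) (by omega)) B).tgt) ∧
            ∀ κ, (rel (blockIter (K - J - 1 - t) z₀) p.src κ).natAbs ≤ θr
        then (fun (μ ν : Fin (F.P K).d) (i : ℕ) (x : Site (F.P K) i) =>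
      (if h : μ < ν then (if i = 0 then dist1 ((GaugeField.plaqHol (Averaging.iter (fun k => BlockAveraging.blockAvg (P := F.P K) (j := k) ℰp) i U₀) ⟨x, μ, ν, h⟩)⁻¹ *
          GaugeField.plaqHol (Averaging.iter (fun k => BlockAveraging.blockAvg (P := F.P K) (j := k) ℰp) i (fun ℓ => expPoint (ζ ℓ) * U₀ ℓ : GaugeField (F.P K) 0 (Matrix.specialUnitaryGroup (Fin 2) ℂ))) ⟨x, μ, ν, h⟩) else ‖covWalkSum (Averaging.iter (fun k => BlockAveraging.blockAvg (P := F.P K) (j := k) ℰp) i U₀) (fun b => ((X i b : (specialUnitaryLogChart (Fin 2)).lie) : Matrix (Fin 2) (Fin 2) ℂ))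
          (walk x [((μ, true) : Letter (F.P K).d), (ν, true), (μ, false), (ν, false)])‖) else 0)) p.μ p.ν (K - J - 1 - t) p.src
        else 0)‖ ^ 2) t +
      2 * ∑ t ∈ Finset.range (K - J), (F.L : ℝ) ^ t * (fun t => Cst * ∑ B : PBond (F.P J) 0,
      ‖(fun p : Plaq (F.P K) (K - J - 1 - t) =>
        if ∃ z₀ : Site (F.P K) 0, (blockIter (K - J) z₀ = (bondShift (F.sitesPerDir_eq (m := F.m) (K := J) (j := 0) (m' := F.m) (K' := K) (j' := K - J) (by omega)) B).src ∨
            blockIter (K - J) z₀ = (bondShift (F.sitesPerDir_eq (m := F.m) (K := J) (j := 0) (m' := F.m) (K' := K) (j' := K - J) (by omega)) B).tgt) ∧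
            ∀ κ, (rel (blockIter (K - J - 1 - t) z₀) p.src κ).natAbs ≤ θr
        then (Real.exp (‖X (K - J - 1 - t) ⟨p.src, p.μ⟩‖ + ‖X (K - J - 1 - t) ⟨(p.src).shift p.μ, p.ν⟩‖ + ‖X (K - J - 1 - t) ⟨(p.src).shift p.ν, p.μ⟩‖ + ‖X (K - J - 1 - t) ⟨p.src, p.ν⟩‖) - 1 - (‖X (K - J - 1 - t) ⟨p.src, p.μ⟩‖ + ‖X (K - J - 1 - t) ⟨(p.src).shift p.μ, p.ν⟩‖ + ‖X (K - J - 1 - t) ⟨(p.src).shift p.ν, p.μ⟩‖ + ‖X (K - J - 1 - t) ⟨p.src, p.ν⟩‖))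
        else 0)‖ ^ 2) t := by
  have hL0 : (0 : ℝ) ≤ (F.L : ℝ) := Nat.cast_nonneg _
  have hrem : ∀ s : ℝ, 0 ≤ Real.exp s - 1 - s := fun s => by linarith [Real.add_one_le_exp s]
  have hρ0 : ∀ (μ ν : Fin (F.P K).d) (i : ℕ) (x : Site (F.P K) i), (0 : ℝ) ≤ (fun (μ ν : Fin (F.P K).d) (i : ℕ) (x : Site (F.P K) i) =>
      (if h : μ < ν then (if i = 0 then dist1 ((GaugeField.plaqHol (Averaging.iter (fun k => BlockAveraging.blockAvg (P := F.P K) (j := k) ℰp) i U₀) ⟨x, μ, ν, h⟩)⁻¹ *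
          GaugeField.plaqHol (Averaging.iter (fun k => BlockAveraging.blockAvg (P := F.P K) (j := k) ℰp) i (fun ℓ => expPoint (ζ ℓ) * U₀ ℓ : GaugeField (F.P K) 0 (Matrix.specialUnitaryGroup (Fin 2) ℂ))) ⟨x, μ, ν, h⟩) else ‖covWalkSum (Averaging.iter (fun k => BlockAveraging.blockAvg (P := F.P K) (j := k) ℰp) i U₀) (fun b => ((X i b : (specialUnitaryLogChart (Fin 2)).lie) : Matrix (Fin 2) (Fin 2) ℂ))
          (walk x [((μ, true) : Letter (F.P K).d), (ν, true), (μ, false), (ν, false)])‖) else 0)) μ ν i x := by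
    intro μ ν i x
    beta_reduce
    split_ifs
    · exact GaugeGroup.dist1_nonneg _
    · exact norm_nonneg _
    · exact le_rfl
  -- per level `t`: the sum over coarsest bonds
  have key : ∀ t ∈ Finset.range (K - J), (F.L : ℝ) ^ t * (fun t => Cst * ∑ B : PBond (F.P J) 0,
      ‖(fun p : Plaq (F.P K) (K - J - 1 - t) =>
        if ∃ z₀ : Site (F.P K) 0, (blockIter (K - J) z₀ = (bondShift (F.sitesPerDir_eq (m := F.m) (K := J) (j := 0) (m' := F.m) (K' := K) (j' := K - J) (by omega)) B).src ∨
            blockIter (K - J) z₀ = (bondShift (F.sitesPerDir_eq (m := F.m) (K := J) (j := 0) (m' := F.m) (K' := K) (j' := K - J) (by omega)) B).tgt) ∧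
            ∀ κ, (rel (blockIter (K - J - 1 - t) z₀) p.src κ).natAbs ≤ θr
        then dist1 ((GaugeField.plaqHol (Averaging.iter (fun k => BlockAveraging.blockAvg (P := F.P K) (j := k) ℰp) (K - J - 1 - t) U₀) p)⁻¹ *
          GaugeField.plaqHol (Averaging.iter (fun k => BlockAveraging.blockAvg (P := F.P K) (j := k) ℰp) (K - J - 1 - t)
            (fun ℓ => expPoint (ζ ℓ) * U₀ ℓ : GaugeField (F.P K) 0 (Matrix.specialUnitaryGroup (Fin 2) ℂ))) p)
        else 0)‖ ^ 2) t ≤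
      2 * ((F.L : ℝ) ^ t * (fun t => Cst * ∑ B : PBond (F.P J) 0,
      ‖(fun p : Plaq (F.P K) (K - J - 1 - t) =>
        if ∃ z₀ : Site (F.P K) 0, (blockIter (K - J) z₀ = (bondShift (F.sitesPerDir_eq (m := F.m) (K := J) (j := 0) (m' := F.m) (K' := K) (j' := K - J) (by omega)) B).src ∨
            blockIter (K - J) z₀ = (bondShift (F.sitesPerDir_eq (m := F.m) (K := J) (j := 0) (m' := F.m) (K' := K) (j' := K - J) (by omega)) B).tgt) ∧
            ∀ κ, (rel (blockIter (K - J - 1 - t) z₀) p.src κ).natAbs ≤ θr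
        then (fun (μ ν : Fin (F.P K).d) (i : ℕ) (x : Site (F.P K) i) =>
      (if h : μ < ν then (if i = 0 then dist1 ((GaugeField.plaqHol (Averaging.iter (fun k => BlockAveraging.blockAvg (P := F.P K) (j := k) ℰp) i U₀) ⟨x, μ, ν, h⟩)⁻¹ *
          GaugeField.plaqHol (Averaging.iter (fun k => BlockAveraging.blockAvg (P := F.P K) (j := k) ℰp) i (fun ℓ => expPoint (ζ ℓ) * U₀ ℓ : GaugeField (F.P K) 0 (Matrix.specialUnitaryGroup (Fin 2) ℂ))) ⟨x, μ, ν, h⟩) else ‖covWalkSum (Averaging.iter (fun k => BlockAveraging.blockAvg (P := F.P K) (j := k) ℰp) i U₀) (fun b => ((X i b : (specialUnitaryLogChart (Fin 2)).lie) : Matrix (Fin 2) (Fin 2) ℂ))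
          (walk x [((μ, true) : Letter (F.P K).d), (ν, true), (μ, false), (ν, false)])‖) else 0)) p.μ p.ν (K - J - 1 - t) p.src
        else 0)‖ ^ 2) t) + 2 * ((F.L : ℝ) ^ t * (fun t => Cst * ∑ B : PBond (F.P J) 0,
      ‖(fun p : Plaq (F.P K) (K - J - 1 - t) =>
        if ∃ z₀ : Site (F.P K) 0, (blockIter (K - J) z₀ = (bondShift (F.sitesPerDir_eq (m := F.m) (K := J) (j := 0) (m' := F.m) (K' := K) (j' := K - J) (by omega)) B).src ∨
            blockIter (K - J) z₀ = (bondShift (F.sitesPerDir_eq (m := F.m) (K := J) (j := 0) (m' := F.m) (K' := K) (j' := K - J) (by omega)) B).tgt) ∧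
            ∀ κ, (rel (blockIter (K - J - 1 - t) z₀) p.src κ).natAbs ≤ θr
        then (Real.exp (‖X (K - J - 1 - t) ⟨p.src, p.μ⟩‖ + ‖X (K - J - 1 - t) ⟨(p.src).shift p.μ, p.ν⟩‖ + ‖X (K - J - 1 - t) ⟨(p.src).shift p.ν, p.μ⟩‖ + ‖X (K - J - 1 - t) ⟨p.src, p.ν⟩‖) - 1 - (‖X (K - J - 1 - t) ⟨p.src, p.μ⟩‖ + ‖X (K - J - 1 - t) ⟨(p.src).shift p.μ, p.ν⟩‖ + ‖X (K - J - 1 - t) ⟨(p.src).shift p.ν, p.μ⟩‖ + ‖X (K - J - 1 - t) ⟨p.src, p.ν⟩‖))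
        else 0)‖ ^ 2) t) := by
    intro t _
    beta_reduce
    have hB : ∑ B : PBond (F.P J) 0, ‖(fun p : Plaq (F.P K) (K - J - 1 - t) =>
        if ∃ z₀ : Site (F.P K) 0, (blockIter (K - J) z₀ = (bondShift (F.sitesPerDir_eq (m := F.m) (K := J) (j := 0) (m' := F.m) (K' := K) (j' := K - J) (by omega)) B).src ∨
            blockIter (K - J) z₀ = (bondShift (F.sitesPerDir_eq (m := F.m) (K := J) (j := 0) (m' := F.m) (K' := K) (j' := K - J) (by omega)) B).tgt) ∧
            ∀ κ, (rel (blockIter (K - J - 1 - t) z₀) p.src κ).natAbs ≤ θr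
        then dist1 ((GaugeField.plaqHol (Averaging.iter (fun k => BlockAveraging.blockAvg (P := F.P K) (j := k) ℰp) (K - J - 1 - t) U₀) p)⁻¹ *
          GaugeField.plaqHol (Averaging.iter (fun k => BlockAveraging.blockAvg (P := F.P K) (j := k) ℰp) (K - J - 1 - t)
            (fun ℓ => expPoint (ζ ℓ) * U₀ ℓ : GaugeField (F.P K) 0 (Matrix.specialUnitaryGroup (Fin 2) ℂ))) p)
        else 0)‖ ^ 2 ≤
        ∑ B : PBond (F.P J) 0, (2 * ‖(fun p : Plaq (F.P K) (K - J - 1 - t) =>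
        if ∃ z₀ : Site (F.P K) 0, (blockIter (K - J) z₀ = (bondShift (F.sitesPerDir_eq (m := F.m) (K := J) (j := 0) (m' := F.m) (K' := K) (j' := K - J) (by omega)) B).src ∨
            blockIter (K - J) z₀ = (bondShift (F.sitesPerDir_eq (m := F.m) (K := J) (j := 0) (m' := F.m) (K' := K) (j' := K - J) (by omega)) B).tgt) ∧
            ∀ κ, (rel (blockIter (K - J - 1 - t) z₀) p.src κ).natAbs ≤ θr
        then (fun (μ ν : Fin (F.P K).d) (i : ℕ) (x : Site (F.P K) i) =>
      (if h : μ < ν then (if i = 0 then dist1 ((GaugeField.plaqHol (Averaging.iter (fun k => BlockAveraging.blockAvg (P := F.P K) (j := k) ℰp) i U₀) ⟨x, μ, ν, h⟩)⁻¹ *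
          GaugeField.plaqHol (Averaging.iter (fun k => BlockAveraging.blockAvg (P := F.P K) (j := k) ℰp) i (fun ℓ => expPoint (ζ ℓ) * U₀ ℓ : GaugeField (F.P K) 0 (Matrix.specialUnitaryGroup (Fin 2) ℂ))) ⟨x, μ, ν, h⟩) else ‖covWalkSum (Averaging.iter (fun k => BlockAveraging.blockAvg (P := F.P K) (j := k) ℰp) i U₀) (fun b => ((X i b : (specialUnitaryLogChart (Fin 2)).lie) : Matrix (Fin 2) (Fin 2) ℂ))
          (walk x [((μ, true) : Letter (F.P K).d), (ν, true), (μ, false), (ν, false)])‖) else 0)) p.μ p.ν (K - J - 1 - t) p.src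
        else 0)‖ ^ 2 + 2 * ‖(fun p : Plaq (F.P K) (K - J - 1 - t) =>
        if ∃ z₀ : Site (F.P K) 0, (blockIter (K - J) z₀ = (bondShift (F.sitesPerDir_eq (m := F.m) (K := J) (j := 0) (m' := F.m) (K' := K) (j' := K - J) (by omega)) B).src ∨
            blockIter (K - J) z₀ = (bondShift (F.sitesPerDir_eq (m := F.m) (K := J) (j := 0) (m' := F.m) (K' := K) (j' := K - J) (by omega)) B).tgt) ∧
            ∀ κ, (rel (blockIter (K - J - 1 - t) z₀) p.src κ).natAbs ≤ θr
        then (Real.exp (‖X (K - J - 1 - t) ⟨p.src, p.μ⟩‖ + ‖X (K - J - 1 - t) ⟨(p.src).shift p.μ, p.ν⟩‖ + ‖X (K - J - 1 - t) ⟨(p.src).shift p.ν, p.μ⟩‖ + ‖X (K - J - 1 - t) ⟨p.src, p.ν⟩‖) - 1 - (‖X (K - J - 1 - t) ⟨p.src, p.μ⟩‖ + ‖X (K - J - 1 - t) ⟨(p.src).shift p.μ, p.ν⟩‖ + ‖X (K - J - 1 - t) ⟨(p.src).shift p.ν, p.μ⟩‖ + ‖X (K - J - 1 - t) ⟨p.src,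 p.ν⟩‖))
        else 0)‖ ^ 2) := by
      refine Finset.sum_le_sum fun B _ => ?_
      -- one coarsest bond: ‖𝟙·d‖² ≤ 2‖𝟙·ρ‖² + 2‖𝟙·rem‖²
      have hle : ‖(fun p : Plaq (F.P K) (K - J - 1 - t) =>
        if ∃ z₀ : Site (F.P K) 0, (blockIter (K - J) z₀ = (bondShift (F.sitesPerDir_eq (m := F.m) (K := J) (j := 0) (m' := F.m) (K' := K) (j' := K - J) (by omega)) B).src ∨
            blockIter (K - J) z₀ = (bondShift (F.sitesPerDir_eq (m := F.m) (K := J) (j := 0) (m' := F.m) (K' := K) (j' := K - J) (by omega)) B).tgt) ∧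
            ∀ κ, (rel (blockIter (K - J - 1 - t) z₀) p.src κ).natAbs ≤ θr
        then dist1 ((GaugeField.plaqHol (Averaging.iter (fun k => BlockAveraging.blockAvg (P := F.P K) (j := k) ℰp) (K - J - 1 - t) U₀) p)⁻¹ *
          GaugeField.plaqHol (Averaging.iter (fun k => BlockAveraging.blockAvg (P := F.P K) (j := k) ℰp) (K - J - 1 - t)
            (fun ℓ => expPoint (ζ ℓ) * U₀ ℓ : GaugeField (F.P K) 0 (Matrix.specialUnitaryGroup (Fin 2) ℂ))) p)
        else 0)‖ ≤
          ‖(fun p : Plaq (F.P K) (K - J - 1 - t) =>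
        if ∃ z₀ : Site (F.P K) 0, (blockIter (K - J) z₀ = (bondShift (F.sitesPerDir_eq (m := F.m) (K := J) (j := 0) (m' := F.m) (K' := K) (j' := K - J) (by omega)) B).src ∨
            blockIter (K - J) z₀ = (bondShift (F.sitesPerDir_eq (m := F.m) (K := J) (j := 0) (m' := F.m) (K' := K) (j' := K - J) (by omega)) B).tgt) ∧
            ∀ κ, (rel (blockIter (K - J - 1 - t) z₀) p.src κ).natAbs ≤ θr
        then (fun (μ ν : Fin (F.P K).d) (i : ℕ) (x : Site (F.P K) i) =>
      (if h : μ < ν then (if i = 0 then dist1 ((GaugeField.plaqHol (Averaging.iter (fun k => BlockAveraging.blockAvg (P := F.P K) (j := k) ℰp) i U₀) ⟨x, μ, ν, h⟩)⁻¹ *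
          GaugeField.plaqHol (Averaging.iter (fun k => BlockAveraging.blockAvg (P := F.P K) (j := k) ℰp) i (fun ℓ => expPoint (ζ ℓ) * U₀ ℓ : GaugeField (F.P K) 0 (Matrix.specialUnitaryGroup (Fin 2) ℂ))) ⟨x, μ, ν, h⟩) else ‖covWalkSum (Averaging.iter (fun k => BlockAveraging.blockAvg (P := F.P K) (j := k) ℰp) i U₀) (fun b => ((X i b : (specialUnitaryLogChart (Fin 2)).lie) : Matrix (Fin 2) (Fin 2) ℂ))
          (walk x [((μ, true) : Letter (F.P K).d), (ν, true), (μ, false), (ν, false)])‖) else 0)) p.μ p.ν (K - J - 1 - t) p.src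
        else 0)‖ +
          ‖(fun p : Plaq (F.P K) (K - J - 1 - t) =>
        if ∃ z₀ : Site (F.P K) 0, (blockIter (K - J) z₀ = (bondShift (F.sitesPerDir_eq (m := F.m) (K := J) (j := 0) (m' := F.m) (K' := K) (j' := K - J) (by omega)) B).src ∨
            blockIter (K - J) z₀ = (bondShift (F.sitesPerDir_eq (m := F.m) (K := J) (j := 0) (m' := F.m) (K' := K) (j' := K - J) (by omega)) B).tgt) ∧
            ∀ κ, (rel (blockIter (K - J - 1 - t) z₀) p.src κ).natAbs ≤ θr
        then (Real.exp (‖X (K - J - 1 - t) ⟨p.src, p.μ⟩‖ + ‖X (K - J - 1 - t) ⟨(p.src).shift p.μ, p.ν⟩‖ + ‖X (K - J - 1 - t) ⟨(p.src).shift p.ν, p.μ⟩‖ + ‖X (K - J - 1 - t) ⟨p.src, p.ν⟩‖) - 1 - (‖X (K - J - 1 - t) ⟨p.src, p.μ⟩‖ + ‖X (K - J - 1 - t) ⟨(p.src).shift p.μ, p.ν⟩‖ + ‖X (K - J - 1 - t) ⟨(p.src).shift p.ν, p.μ⟩‖ + ‖X (K - J - 1 - t) ⟨p.src, p.ν⟩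‖))
        else 0)‖ := by
        refine (pi_norm_le_iff_of_nonneg (add_nonneg (norm_nonneg _) (norm_nonneg _))).2 fun p => ?_
        refine le_trans ?_ (add_le_add (norm_le_pi_norm _ p) (norm_le_pi_norm _ p))
        by_cases hc : ∃ z₀ : Site (F.P K) 0, (blockIter (K - J) z₀ = (bondShift (F.sitesPerDir_eq (m := F.m) (K := J) (j := 0) (m' := F.m) (K' := K) (j' := K - J) (by omega)) B).src ∨
            blockIter (K - J) z₀ = (bondShift (F.sitesPerDir_eq (m := F.m) (K := J) (j := 0) (m' := F.m) (K' := K) (j' := K - J) (by omega)) B).tgt) ∧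
            ∀ κ, (rel (blockIter (K - J - 1 - t) z₀) p.src κ).natAbs ≤ θr
        · simp only [hc, if_true]
          rw [Real.norm_of_nonneg (GaugeGroup.dist1_nonneg _), Real.norm_of_nonneg (hρ0 _ _ _ _), Real.norm_of_nonneg (hrem _)]
          exact dist_le_rho_add_rem F U₀ ζ X hXdef (K - J - 1 - t) p
        · simp only [hc, if_false, norm_zero, add_zero]
          exact le_rfl
      exact sq_le_two_sq_add_two_sq_of_le_add (norm_nonneg _) hle
    calc (F.L : ℝ) ^ t * (Cst * ∑ B : PBond (F.P J) 0, ‖(fun p : Plaq (F.P K) (K - J - 1 - t) =>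
        if ∃ z₀ : Site (F.P K) 0, (blockIter (K - J) z₀ = (bondShift (F.sitesPerDir_eq (m := F.m) (K := J) (j := 0) (m' := F.m) (K' := K) (j' := K - J) (by omega)) B).src ∨
            blockIter (K - J) z₀ = (bondShift (F.sitesPerDir_eq (m := F.m) (K := J) (j := 0) (m' := F.m) (K' := K) (j' := K - J) (by omega)) B).tgt) ∧
            ∀ κ, (rel (blockIter (K - J - 1 - t) z₀) p.src κ).natAbs ≤ θr
        then dist1 ((GaugeField.plaqHol (Averaging.iter (fun k => BlockAveraging.blockAvg (P := F.P K) (j := k) ℰp) (K - J - 1 - t) U₀) p)⁻¹ *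
          GaugeField.plaqHol (Averaging.iter (fun k => BlockAveraging.blockAvg (P := F.P K) (j := k) ℰp) (K - J - 1 - t)
            (fun ℓ => expPoint (ζ ℓ) * U₀ ℓ : GaugeField (F.P K) 0 (Matrix.specialUnitaryGroup (Fin 2) ℂ))) p)
        else 0)‖ ^ 2)
        ≤ (F.L : ℝ) ^ t * (Cst * ∑ B : PBond (F.P J) 0, (2 * ‖(fun p : Plaq (F.P K) (K - J - 1 - t) =>
        if ∃ z₀ : Site (F.P K) 0, (blockIter (K - J) z₀ = (bondShift (F.sitesPerDir_eq (m := F.m) (K := J) (j := 0) (m' := F.m) (K' := K) (j' := K - J) (by omega)) B).src ∨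
            blockIter (K - J) z₀ = (bondShift (F.sitesPerDir_eq (m := F.m) (K := J) (j := 0) (m' := F.m) (K' := K) (j' := K - J) (by omega)) B).tgt) ∧
            ∀ κ, (rel (blockIter (K - J - 1 - t) z₀) p.src κ).natAbs ≤ θr
        then (fun (μ ν : Fin (F.P K).d) (i : ℕ) (x : Site (F.P K) i) =>
      (if h : μ < ν then (if i = 0 then dist1 ((GaugeField.plaqHol (Averaging.iter (fun k => BlockAveraging.blockAvg (P := F.P K) (j := k) ℰp) i U₀) ⟨x, μ, ν, h⟩)⁻¹ *
          GaugeField.plaqHol (Averaging.iter (fun k => BlockAveraging.blockAvg (P := F.P K) (j := k) ℰp) i (fun ℓ => expPoint (ζ ℓ) * U₀ ℓ : GaugeField (F.P K) 0 (Matrix.specialUnitaryGroup (Fin 2) ℂ))) ⟨x, μ, ν, h⟩) else ‖covWalkSum (Averaging.iter (fun k => BlockAveraging.blockAvg (P := F.P K) (j := k) ℰp) i U₀) (fun b => ((X i b : (specialUnitaryLogChart (Fin 2)).lie) : Matrix (Fin 2) (Fin 2) ℂ))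
          (walk x [((μ, true) : Letter (F.P K).d), (ν, true), (μ, false), (ν, false)])‖) else 0)) p.μ p.ν (K - J - 1 - t) p.src
        else 0)‖ ^ 2 + 2 * ‖(fun p : Plaq (F.P K) (K - J - 1 - t) =>
        if ∃ z₀ : Site (F.P K) 0, (blockIter (K - J) z₀ = (bondShift (F.sitesPerDir_eq (m := F.m) (K := J) (j := 0) (m' := F.m) (K' := K) (j' := K - J) (by omega)) B).src ∨
            blockIter (K - J) z₀ = (bondShift (F.sitesPerDir_eq (m := F.m) (K := J) (j := 0) (m' := F.m) (K' := K) (j' := K - J) (by omega)) B).tgt) ∧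
            ∀ κ, (rel (blockIter (K - J - 1 - t) z₀) p.src κ).natAbs ≤ θr
        then (Real.exp (‖X (K - J - 1 - t) ⟨p.src, p.μ⟩‖ + ‖X (K - J - 1 - t) ⟨(p.src).shift p.μ, p.ν⟩‖ + ‖X (K - J - 1 - t) ⟨(p.src).shift p.ν, p.μ⟩‖ + ‖X (K - J - 1 - t) ⟨p.src, p.ν⟩‖) - 1 - (‖X (K - J - 1 - t) ⟨p.src, p.μ⟩‖ + ‖X (K - J - 1 - t) ⟨(p.src).shift p.μ, p.ν⟩‖ + ‖X (K - J - 1 - t) ⟨(p.src).shift p.ν, p.μ⟩‖ + ‖X (K - J - 1 - t) ⟨p.src, p.ν⟩‖))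
        else 0)‖ ^ 2)) :=
          mul_le_mul_of_nonneg_left (mul_le_mul_of_nonneg_left hB hCst) (pow_nonneg hL0 _)
      _ = _ := by rw [Finset.sum_add_distrib, ← Finset.mul_sum, ← Finset.mul_sum]; ring
  calc _ ≤ ∑ t ∈ Finset.range (K - J), (2 * ((F.L : ℝ) ^ t * (fun t => Cst * ∑ B : PBond (F.P J) 0,
      ‖(fun p : Plaq (F.P K) (K - J - 1 - t) =>
        if ∃ z₀ : Site (F.P K) 0, (blockIter (K - J) z₀ = (bondShift (F.sitesPerDir_eq (m := F.m) (K := J) (j := 0) (m' := F.m) (K' := K) (j' := K - J) (by omega)) B).src ∨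
            blockIter (K - J) z₀ = (bondShift (F.sitesPerDir_eq (m := F.m) (K := J) (j := 0) (m' := F.m) (K' := K) (j' := K - J) (by omega)) B).tgt) ∧
            ∀ κ, (rel (blockIter (K - J - 1 - t) z₀) p.src κ).natAbs ≤ θr
        then (fun (μ ν : Fin (F.P K).d) (i : ℕ) (x : Site (F.P K) i) =>
      (if h : μ < ν then (if i = 0 then dist1 ((GaugeField.plaqHol (Averaging.iter (fun k => BlockAveraging.blockAvg (P := F.P K) (j := k) ℰp) i U₀) ⟨x, μ, ν, h⟩)⁻¹ *
          GaugeField.plaqHol (Averaging.iter (fun k => BlockAveraging.blockAvg (P := F.P K) (j := k) ℰp) i (fun ℓ => expPoint (ζ ℓ) * U₀ ℓ : GaugeField (F.P K) 0 (Matrix.specialUnitaryGroup (Fin 2) ℂ))) ⟨x, μ, ν, h⟩) else ‖covWalkSum (Averaging.iter (fun k => BlockAveraging.blockAvg (P := F.P K) (j := k) ℰp) i U₀) (fun b => ((X i b : (specialUnitaryLogChart (Fin 2)).lie) : Matrix (Fin 2) (Fin 2) ℂ))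
          (walk x [((μ, true) : Letter (F.P K).d), (ν, true), (μ, false), (ν, false)])‖) else 0)) p.μ p.ν (K - J - 1 - t) p.src
        else 0)‖ ^ 2) t) + 2 * ((F.L : ℝ) ^ t * (fun t => Cst * ∑ B : PBond (F.P J) 0,
      ‖(fun p : Plaq (F.P K) (K - J - 1 - t) =>
        if ∃ z₀ : Site (F.P K) 0, (blockIter (K - J) z₀ = (bondShift (F.sitesPerDir_eq (m := F.m) (K := J) (j := 0) (m' := F.m) (K' := K) (j' := K - J) (by omega)) B).src ∨
            blockIter (K - J) z₀ = (bondShift (F.sitesPerDir_eq (m := F.m) (K := J) (j := 0) (m' := F.m) (K' := K) (j' := K - J) (by omega)) B).tgt) ∧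
            ∀ κ, (rel (blockIter (K - J - 1 - t) z₀) p.src κ).natAbs ≤ θr
        then (Real.exp (‖X (K - J - 1 - t) ⟨p.src, p.μ⟩‖ + ‖X (K - J - 1 - t) ⟨(p.src).shift p.μ, p.ν⟩‖ + ‖X (K - J - 1 - t) ⟨(p.src).shift p.ν, p.μ⟩‖ + ‖X (K - J - 1 - t) ⟨p.src, p.ν⟩‖) - 1 - (‖X (K - J - 1 - t) ⟨p.src, p.μ⟩‖ + ‖X (K - J - 1 - t) ⟨(p.src).shift p.μ, p.ν⟩‖ + ‖X (K - J - 1 - t) ⟨(p.src).shift p.ν, p.μ⟩‖ + ‖X (K - J - 1 - t) ⟨p.src, p.ν⟩‖))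
        else 0)‖ ^ 2) t)) := Finset.sum_le_sum key
    _ = _ := by rw [Finset.sum_add_distrib, ← Finset.mul_sum, ← Finset.mul_sum]

end Summit.QuantumFields.YangMills.Theorems.FluctuationComparisonRegPrIntLS2BetaCurlBudgetJunctionSplit

end
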